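import Summits.QuantumFields.YangMills.Theorems.LuscherReductionDressedRitzPolyakovLiftPScalingCore
import HarnessLib

/-!
# Route `LuscherReduction`, item `DressedRitz` (stmt-QuantumFields-20205), line «polyakovlift» r7, stub S-PSCAL″ — THE DRESSED CLAUSES FROM
# WINDOW CONCENTRATION, with a SATISFIABLE cluster-gap hypothesis (seat ym-20205-polyakovlift-w1a g1 over the LEAD's `…PScalingCore`; helper `--supports`)

The LEAD's `PScal.dressed_clauses_of_concentration` (tree `…PScalingCore`, p566328) asks `hgapτ : λ_{hi i} ≤ e^{−τ}·lamlow` with ONE global window floor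
`lamlow` (below every window).  As soon as the shadow family spans two 𝔥-clusters this is unsatisfiable: for the lowest window, `λ_{hi i}` is the top of the
next cluster, which lies ABOVE the global floor.  The hypothesis is used once (the cut index `M = max(hi i, hi l)` satisfies `λ_M ≤ κ`); what that step needs is
only `λ_{hi i} ≤ e^{−τ}·λ_{i+1}` per vector (the next cluster sits `γ·x ≫ τ` below).  This file re-states the theorem with that hypothesis
(★★ `dressed_clauses_of_concentration'`); the proof is the LEAD's verbatim except for the three-line derivation of `λ_M ≤ κ`
(`λ_M ≤ e^{−τ}λ_{i+1} ≤ ρ_i`, `λ_M ≤ e^{−τ}λ_{l+1} ≤ ρ_l`, average).  The single global `lamlow`/`Γ` stay (quantitatively harmless: ratios of cluster floors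
below a fixed cluster end are `e^{O(Λ)}`).

HONEST FRAMING: fixed-lattice spectral bookkeeping (conditional femto rung R2b1); nothing here bears on infinite volume, the continuum limit or the Clay gap.
References: Reed–Simon IV, Thm. XIII.1 [cite: ReedSimonIV1978, Thm. XIII.1]; M. Lüscher, NPB 219 (1983) 233 [cite: Luscher1983, §3].
-/

set_option autoImplicit false

noncomputable section

open MeasureTheory Filter Topology Real Finset
open Literature.MathematicalPhysics.QuantumFieldTheory (GaugeConfig Site gaugeTransform)
open scoped BigOperators

namespace Summit.QuantumFields.YangMills.Theorems.FemtoTransferGap.PScal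

open Summit.QuantumFields.YangMills.Theorems.FemtoTransferGap
open Summit.QuantumFields.YangMills.Theorems.FemtoTransferGap.SpecSum (ratio_two_sided cross_sharp dressed_norm_lower sum_le_of_hasSum)

variable {L : ℕ} [NeZero L]

/-- ★★ **Dressed clauses from window concentration, satisfiable gap form** (`hgapτ : λ_{hi i} ≤ e^{−τ}λ_{i+1}`); otherwise as
`dressed_clauses_of_concentration`. [cite: ReedSimonIV1978, Thm. XIII.1] [cite: Luscher1983, §3] -/
theorem dressed_clauses_of_concentration' {β : ℝ} {e : ℕ → GaugeConfig 3 L SU2 → ℝ}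
    (hsum : ∀ (v w : GaugeConfig 3 L SU2 → ℝ), IsPhys v → IsPhys w → ∀ m n : ℕ, 1 ≤ m + n →
      HasSum (fun k => levelValue su2Rep L β k ^ (m + n) * l2 w (e k) * l2 v (e k))
        (l2 ((transferApply β)^[m] w) ((transferApply β)^[n] v)))
    (hbes : ∀ v : GaugeConfig 3 L SU2 → ℝ, IsPhys v → Summable (fun k => l2 v (e k) ^ 2) ∧ ∑' k, l2 v (e k) ^ 2 ≤ l2 v v)
    (hanti : Antitone fun k => levelValue su2Rep L β k) (hnn : ∀ k, 0 ≤ levelValue su2Rep L β k)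
    {n : ℕ} (hn : 1 ≤ n) {kk : ℕ} (v : Fin kk → GaugeConfig 3 L SU2 → ℝ) (hv : ∀ i, IsPhys (v i))
    (lo hi : Fin kk → ℕ) (hlo : ∀ i : Fin kk, lo i ≤ (i : ℕ) + 1) (hhi : ∀ i : Fin kk, (i : ℕ) + 1 < hi i)
    {σ lamlow Γ ϑ τ : ℝ}
    (hσ : ∀ (i : Fin kk) (k : ℕ), lo i ≤ k → k < hi i → |levelValue su2Rep L β k - levelValue su2Rep L β ((i : ℕ) + 1)| ≤ σ)
    (hlow0 : 0 < lamlow) (hlow : ∀ (i : Fin kk) (k : ℕ), lo i ≤ k → k < hi i → lamlow ≤ levelValue su2Rep L β k)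
    (hΓ : levelValue su2Rep L β 0 ^ (2 * n) ≤ Γ * lamlow ^ (2 * n))
    (hϑ0 : 0 ≤ ϑ)
    (hconc : ∀ i : Fin kk, l2 (v i) (v i) ≤ (1 + ϑ) * ∑ k ∈ Ico (lo i) (hi i), l2 (v i) (e k) ^ 2)
    (hin : ∀ i : Fin kk, 0 < ∑ k ∈ Ico (lo i) (hi i), l2 (v i) (e k) ^ 2)
    (hτ0 : 0 ≤ τ) (hτ1 : τ ≤ 1)
    (hup : ∀ i : Fin kk, Γ * ((levelValue su2Rep L β 0 - levelValue su2Rep L β ((i : ℕ) + 1)) * ϑ + σ) ≤ τ * levelValue su2Rep L β ((i : ℕ) + 1))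
    (hlo' : ∀ i : Fin kk, Γ * (σ + levelValue su2Rep L β ((i : ℕ) + 1) * ϑ / (2 * (n : ℝ) + 1)) ≤ τ / 2 * levelValue su2Rep L β ((i : ℕ) + 1))
    (hgapτ : ∀ i : Fin kk, levelValue su2Rep L β (hi i) ≤ Real.exp (-τ) * levelValue su2Rep L β ((i : ℕ) + 1)) :
    (∀ i : Fin kk, 0 < l2 ((transferApply β)^[n] (v i)) ((transferApply β)^[n] (v i))) ∧
    (∀ i : Fin kk,
      l2 ((transferApply β)^[n] (v i)) (transferApply β ((transferApply β)^[n] (v i))) ≤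
          Real.exp τ * (levelValue su2Rep L β ((i : ℕ) + 1) * l2 ((transferApply β)^[n] (v i)) ((transferApply β)^[n] (v i))) ∧
        levelValue su2Rep L β ((i : ℕ) + 1) * l2 ((transferApply β)^[n] (v i)) ((transferApply β)^[n] (v i)) ≤
          Real.exp τ * l2 ((transferApply β)^[n] (v i)) (transferApply β ((transferApply β)^[n] (v i)))) ∧
    (∀ i l : Fin kk, i ≠ l →
      |l2 ((transferApply β)^[n] (v i)) (transferApply β ((transferApply β)^[n] (v l))) -
          (l2 ((transferApply β)^[n] (v i)) (transferApply β ((transferApply β)^[n] (v i))) /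
                l2 ((transferApply β)^[n] (v i)) ((transferApply β)^[n] (v i)) +
              l2 ((transferApply β)^[n] (v l)) (transferApply β ((transferApply β)^[n] (v l))) /
                l2 ((transferApply β)^[n] (v l)) ((transferApply β)^[n] (v l))) / 2 *
            l2 ((transferApply β)^[n] (v i)) ((transferApply β)^[n] (v l))|
        ≤ ((1 + ϑ) * Γ * (σ + (Real.exp τ - 1) * levelValue su2Rep L β 0 +
              2 * Real.sqrt ϑ * (Real.exp τ * levelValue su2Rep L β 0 - Real.exp (-τ) * lamlow) +
              Real.exp ((2 * (n : ℝ) + 1) * τ) * levelValue su2Rep L β 0 * ϑ / (2 * (n : ℝ) + 1))) *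
          (Real.sqrt (l2 ((transferApply β)^[n] (v i)) ((transferApply β)^[n] (v i))) *
            Real.sqrt (l2 ((transferApply β)^[n] (v l)) ((transferApply β)^[n] (v l))))) := by
  set K := transferApply (L := L) β with hKdef
  set lam : ℕ → ℝ := fun k => levelValue su2Rep L β k with hlamdef
  have hanti' : Antitone lam := hanti
  -- coefficient sequences
  set a : Fin kk → ℕ → ℝ := fun i k => l2 (v i) (e k) with hadef
  -- series
  have hN : ∀ i, HasSum (fun k => lam k ^ (2 * n) * a i k ^ 2) (l2 (K^[n] (v i)) (K^[n] (v i))) := fun i => hasSum_N hsum (hv i) hn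
  have hD : ∀ i, HasSum (fun k => lam k ^ (2 * n + 1) * a i k ^ 2) (l2 (K^[n] (v i)) (K (K^[n] (v i)))) := fun i =>
    hasSum_D hsum (hv i) n hn
  have hA : ∀ i, HasSum (fun k => a i k ^ 2) (∑' k, a i k ^ 2) := fun i => (hbes (v i) (hv i)).1.hasSum
  have hAnv : ∀ i, ∑' k, a i k ^ 2 ≤ l2 (v i) (v i) := fun i => (hbes (v i) (hv i)).2
  have hposc : ∀ i : Fin kk, 0 < lam ((i : ℕ) + 1) := fun i => lt_of_lt_of_le hlow0 (hlow i _ (hlo i) (hhi i))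
  -- per-vector ratio clause
  have hR : ∀ i, 0 < l2 (K^[n] (v i)) (K^[n] (v i)) ∧
      l2 (K^[n] (v i)) (K (K^[n] (v i))) ≤ Real.exp τ * (lam ((i : ℕ) + 1) * l2 (K^[n] (v i)) (K^[n] (v i))) ∧
      lam ((i : ℕ) + 1) * l2 (K^[n] (v i)) (K^[n] (v i)) ≤ Real.exp τ * l2 (K^[n] (v i)) (K (K^[n] (v i))) := fun i =>
    ratio_two_sided hanti' hnn n (hlo i) (hhi i) (hσ i) (hN i) (hD i) (hA i) (hAnv i) (hposc i) hlow0 (hlow i) hΓ hϑ0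
      (hconc i) (hin i) hτ0 hτ1 (hup i) (hlo' i)
  refine ⟨fun i => (hR i).1, fun i => (hR i).2, ?_⟩
  -- the cross clause
  intro i l hil
  have hNi := (hR i).1
  have hNl := (hR l).1
  set Ni := l2 (K^[n] (v i)) (K^[n] (v i)) with hNidef
  set Nl := l2 (K^[n] (v l)) (K^[n] (v l)) with hNldef
  set Di := l2 (K^[n] (v i)) (K (K^[n] (v i))) with hDidef
  set Dl := l2 (K^[n] (v l)) (K (K^[n] (v l))) with hDldef
  set ρi := Di / Ni with hρi
  set ρl := Dl / Nl with hρl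
  set κ := (ρi + ρl) / 2 with hκdef
  have hmemi := ratio_mem_Icc hNi (hR i).2.1 (hR i).2.2
  have hmeml := ratio_mem_Icc hNl (hR l).2.1 (hR l).2.2
  have hposi := hposc i
  have hposl := hposc l
  have he1 : 1 ≤ Real.exp τ := Real.one_le_exp hτ0
  have heτ : 0 < Real.exp (-τ) := Real.exp_pos _
  have heτ1 : Real.exp (-τ) ≤ 1 := by rw [Real.exp_neg]; exact inv_le_one_of_one_le₀ he1
  have hlowi : lamlow ≤ lam ((i : ℕ) + 1) := hlow i _ (hlo i) (hhi i)
  have hlowl : lamlow ≤ lam ((l : ℕ) + 1) := hlow l _ (hlo l) (hhi l)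
  have hl0i : lam ((i : ℕ) + 1) ≤ lam 0 := hanti' (Nat.zero_le _)
  have hl0l : lam ((l : ℕ) + 1) ≤ lam 0 := hanti' (Nat.zero_le _)
  -- κ ∈ [e^{-τ}λ_low, e^{τ}λ_0]
  have hκlo : Real.exp (-τ) * lamlow ≤ κ := by
    have h1 : Real.exp (-τ) * lamlow ≤ ρi := le_trans (mul_le_mul_of_nonneg_left hlowi heτ.le) hmemi.1
    have h2 : Real.exp (-τ) * lamlow ≤ ρl := le_trans (mul_le_mul_of_nonneg_left hlowl heτ.le) hmeml.1
    rw [hκdef]; linarith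
  have hκhi : κ ≤ Real.exp τ * lam 0 := by
    have h1 : ρi ≤ Real.exp τ * lam 0 := hmemi.2.trans (mul_le_mul_of_nonneg_left hl0i (Real.exp_pos τ).le)
    have h2 : ρl ≤ Real.exp τ * lam 0 := hmeml.2.trans (mul_le_mul_of_nonneg_left hl0l (Real.exp_pos τ).le)
    rw [hκdef]; linarith
  have hκ0 : 0 ≤ κ := le_trans (mul_nonneg heτ.le hlow0.le) hκlo
  -- cut index
  set M := max (hi i) (hi l) with hMdef
  have hκM : lam M ≤ κ := by
    have h1 : lam M ≤ Real.exp (-τ) * lam ((i : ℕ) + 1) := (hanti' (le_max_left _ _)).trans (hgapτ i)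
    have h2 : lam M ≤ Real.exp (-τ) * lam ((l : ℕ) + 1) := (hanti' (le_max_right _ _)).trans (hgapτ l)
    have h3 : Real.exp (-τ) * lam ((i : ℕ) + 1) ≤ ρi := hmemi.1
    have h4 : Real.exp (-τ) * lam ((l : ℕ) + 1) ≤ ρl := hmeml.1
    rw [hκdef]; linarith
  -- windows
  have hWi : Ico (lo i) (hi i) ⊆ range M := fun k hk => mem_range.2 ((mem_Ico.1 hk).2.trans_le (le_max_left _ _))
  have hWl : Ico (lo l) (hi l) ⊆ range M := fun k hk => mem_range.2 ((mem_Ico.1 hk).2.trans_le (le_max_right _ _))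
  -- weights
  set ω₀ := Real.exp τ * lam 0 - Real.exp (-τ) * lamlow with hω₀
  set ω₁ := σ + (Real.exp τ - 1) * lam 0 with hω₁
  have hσ0 : 0 ≤ σ := (abs_nonneg _).trans (hσ i _ (hlo i) (hhi i))
  have hω₀0 : 0 ≤ ω₀ := by
    rw [hω₀]
    have : Real.exp (-τ) * lamlow ≤ Real.exp τ * lam 0 := hκlo.trans hκhi
    linarith
  have hω₁0 : 0 ≤ ω₁ := by
    rw [hω₁]
    have : 0 ≤ (Real.exp τ - 1) * lam 0 := mul_nonneg (by linarith) (hnn 0)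
    linarith
  have hw₀ : ∀ k, k < M → |lam k - κ| ≤ ω₀ := by
    intro k hk
    have hk0 : lam k ≤ lam 0 := hanti' (Nat.zero_le k)
    have hklow : lamlow ≤ lam k := by
      rcases lt_max_iff.1 hk with h | h
      · have h1 : lamlow ≤ lam (hi i - 1) := hlow i _ (by have := hlo i; have := hhi i; omega) (by have := hhi i; omega)
        exact h1.trans (hanti' (by omega))
      · have h1 : lamlow ≤ lam (hi l - 1) := hlow l _ (by have := hlo l; have := hhi l; omega) (by have := hhi l; omega)
        exact h1.trans (hanti' (by omega))
    have hup' : lam k ≤ Real.exp τ * lam 0 := hk0.trans (by nlinarith [hnn 0])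
    have hdn' : Real.exp (-τ) * lamlow ≤ lam k := le_trans (by nlinarith) hklow
    rw [abs_le, hω₀]
    constructor <;> linarith
  have hw₁ : ∀ k ∈ Ico (lo i) (hi i) ∩ Ico (lo l) (hi l), |lam k - κ| ≤ ω₁ := by
    intro k hk
    rw [mem_inter, mem_Ico, mem_Ico] at hk
    have h1 : |lam k - lam ((i : ℕ) + 1)| ≤ σ := hσ i k hk.1.1 hk.1.2
    have h2 : |lam k - lam ((l : ℕ) + 1)| ≤ σ := hσ l k hk.2.1 hk.2.2
    have h3 := abs_ratio_sub_le hNi hposi.le hτ0 (hR i).2.1 (hR i).2.2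
    have h4 := abs_ratio_sub_le hNl hposl.le hτ0 (hR l).2.1 (hR l).2.2
    have h5 : (Real.exp τ - 1) * lam ((i : ℕ) + 1) ≤ (Real.exp τ - 1) * lam 0 := mul_le_mul_of_nonneg_left hl0i (by linarith)
    have h6 : (Real.exp τ - 1) * lam ((l : ℕ) + 1) ≤ (Real.exp τ - 1) * lam 0 := mul_le_mul_of_nonneg_left hl0l (by linarith)
    rw [abs_le] at h1 h2 h3 h4 ⊢
    rw [hω₁, hκdef]
    constructor <;> linarith [h1.1, h1.2, h2.1, h2.2, h3.1, h3.2, h4.1, h4.2]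
  -- positivity of the undressed norms
  have hsub : ∀ j : Fin kk, ∑ k ∈ Ico (lo j) (hi j), a j k ^ 2 ≤ l2 (v j) (v j) := fun j =>
    ((Finset.sum_le_sum_of_subset_of_nonneg (fun k hk => mem_range.2 (mem_Ico.1 hk).2) fun k _ _ => sq_nonneg (a j k)).trans
      (sum_le_of_hasSum (hA j) (fun k => sq_nonneg _) (hi j))).trans (hAnv j)
  have hnvi : 0 < l2 (v i) (v i) := lt_of_lt_of_le (hin i) (hsub i)
  have hnvl : 0 < l2 (v l) (v l) := lt_of_lt_of_le (hin l) (hsub l)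
  -- the cross series
  have hNab := hasSum_Nab hsum (hv l) (hv i) hn
  have hDab := hasSum_Dab hsum (hv l) (hv i) n hn
  have hX := cross_sharp (a := a i) (b := a l) hanti' hnn n M hκM hκ0 hNab hDab (hA i) (hA l) (hAnv i) (hAnv l) hnvi hnvl hWi hWl hϑ0
    (hconc i) (hconc l) hω₀0 hω₁0 hw₀ hw₁
  -- convert `√nv_i √nv_l` and the level powers
  have hNlow : ∀ j, lamlow ^ (2 * n) * ∑ k ∈ Ico (lo j) (hi j), a j k ^ 2 ≤ l2 (K^[n] (v j)) (K^[n] (v j)) := fun j =>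
    dressed_norm_lower hnn n hlow0.le (hlow j) (hN j)
  have hlowpow : 0 < lamlow ^ (2 * n) := pow_pos hlow0 _
  have hnvN : ∀ j, lamlow ^ (2 * n) * l2 (v j) (v j) ≤ (1 + ϑ) * l2 (K^[n] (v j)) (K^[n] (v j)) := fun j => by
    calc lamlow ^ (2 * n) * l2 (v j) (v j) ≤ lamlow ^ (2 * n) * ((1 + ϑ) * ∑ k ∈ Ico (lo j) (hi j), a j k ^ 2) :=
          mul_le_mul_of_nonneg_left (hconc j) hlowpow.le
      _ = (1 + ϑ) * (lamlow ^ (2 * n) * ∑ k ∈ Ico (lo j) (hi j), a j k ^ 2) := by ring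
      _ ≤ (1 + ϑ) * l2 (K^[n] (v j)) (K^[n] (v j)) := mul_le_mul_of_nonneg_left (hNlow j) (by linarith)
  have hsq : ∀ j, Real.sqrt (lamlow ^ (2 * n)) * Real.sqrt (l2 (v j) (v j)) ≤
      Real.sqrt (1 + ϑ) * Real.sqrt (l2 (K^[n] (v j)) (K^[n] (v j))) := fun j => by
    rw [← Real.sqrt_mul hlowpow.le, ← Real.sqrt_mul (by linarith)]
    exact Real.sqrt_le_sqrt (hnvN j)
  have hden : (0 : ℝ) < 2 * (n : ℝ) + 1 := by positivity
  have hκpow : κ ^ (2 * n + 1) ≤ Real.exp ((2 * (n : ℝ) + 1) * τ) * lam 0 * (Γ * lamlow ^ (2 * n)) := by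
    have h1 : κ ^ (2 * n + 1) ≤ (Real.exp τ * lam 0) ^ (2 * n + 1) := pow_le_pow_left₀ hκ0 hκhi _
    have h2 : (Real.exp τ * lam 0) ^ (2 * n + 1) = Real.exp ((2 * (n : ℝ) + 1) * τ) * lam 0 * lam 0 ^ (2 * n) := by
      rw [mul_pow, ← Real.exp_nat_mul, pow_succ]; push_cast; ring
    have h3 : Real.exp ((2 * (n : ℝ) + 1) * τ) * lam 0 * lam 0 ^ (2 * n) ≤
        Real.exp ((2 * (n : ℝ) + 1) * τ) * lam 0 * (Γ * lamlow ^ (2 * n)) :=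
      mul_le_mul_of_nonneg_left hΓ (mul_nonneg (Real.exp_pos _).le (hnn 0))
    linarith
  set c3 := Real.exp ((2 * (n : ℝ) + 1) * τ) * lam 0 * ϑ / (2 * (n : ℝ) + 1) with hc3
  have hc30 : 0 ≤ c3 := div_nonneg (mul_nonneg (mul_nonneg (Real.exp_pos _).le (hnn 0)) hϑ0) hden.le
  have hωsum : 0 ≤ ω₁ + 2 * Real.sqrt ϑ * ω₀ := add_nonneg hω₁0 (mul_nonneg (mul_nonneg (by norm_num) (Real.sqrt_nonneg _)) hω₀0)
  have hcoef : lam 0 ^ (2 * n) * (ω₁ + 2 * Real.sqrt ϑ * ω₀) + κ ^ (2 * n + 1) / (2 * (n : ℝ) + 1) * ϑ ≤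
      Γ * lamlow ^ (2 * n) * (ω₁ + 2 * Real.sqrt ϑ * ω₀ + c3) := by
    have h1 : lam 0 ^ (2 * n) * (ω₁ + 2 * Real.sqrt ϑ * ω₀) ≤ Γ * lamlow ^ (2 * n) * (ω₁ + 2 * Real.sqrt ϑ * ω₀) :=
      mul_le_mul_of_nonneg_right hΓ hωsum
    have h2 : κ ^ (2 * n + 1) / (2 * (n : ℝ) + 1) * ϑ ≤
        Real.exp ((2 * (n : ℝ) + 1) * τ) * lam 0 * (Γ * lamlow ^ (2 * n)) / (2 * (n : ℝ) + 1) * ϑ :=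
      mul_le_mul_of_nonneg_right (div_le_div_of_nonneg_right hκpow hden.le) hϑ0
    have e : Real.exp ((2 * (n : ℝ) + 1) * τ) * lam 0 * (Γ * lamlow ^ (2 * n)) / (2 * (n : ℝ) + 1) * ϑ =
        Γ * lamlow ^ (2 * n) * c3 := by
      rw [hc3]; field_simp
    linarith [h1, h2, e]
  -- assemble
  have hss0 : 0 ≤ Real.sqrt (l2 (v i) (v i)) * Real.sqrt (l2 (v l) (v l)) := by positivity
  have hΩ' : 0 ≤ ω₁ + 2 * Real.sqrt ϑ * ω₀ + c3 := add_nonneg hωsum hc30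
  have hΓ0 : 0 ≤ Γ := by
    have : 0 ≤ lam 0 ^ (2 * n) := pow_nonneg (hnn 0) _
    by_contra hneg
    push Not at hneg
    have : Γ * lamlow ^ (2 * n) < 0 := mul_neg_of_neg_of_pos hneg hlowpow
    linarith
  have hfin : |l2 (K^[n] (v i)) (K (K^[n] (v l))) - κ * l2 (K^[n] (v i)) (K^[n] (v l))| ≤
      (1 + ϑ) * Γ * (ω₁ + 2 * Real.sqrt ϑ * ω₀ + c3) * (Real.sqrt Ni * Real.sqrt Nl) := by
    calc |l2 (K^[n] (v i)) (K (K^[n] (v l))) - κ * l2 (K^[n] (v i)) (K^[n] (v l))|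
        ≤ (lam 0 ^ (2 * n) * (ω₁ + 2 * Real.sqrt ϑ * ω₀) + κ ^ (2 * n + 1) / (2 * (n : ℝ) + 1) * ϑ) *
            (Real.sqrt (l2 (v i) (v i)) * Real.sqrt (l2 (v l) (v l))) := hX
      _ ≤ Γ * lamlow ^ (2 * n) * (ω₁ + 2 * Real.sqrt ϑ * ω₀ + c3) *
            (Real.sqrt (l2 (v i) (v i)) * Real.sqrt (l2 (v l) (v l))) := mul_le_mul_of_nonneg_right hcoef hss0
      _ = Γ * (ω₁ + 2 * Real.sqrt ϑ * ω₀ + c3) *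
            ((Real.sqrt (lamlow ^ (2 * n)) * Real.sqrt (l2 (v i) (v i))) * (Real.sqrt (lamlow ^ (2 * n)) * Real.sqrt (l2 (v l) (v l)))) :=
          cross_rearrange Γ _ _ _ _ hlowpow.le
      _ ≤ Γ * (ω₁ + 2 * Real.sqrt ϑ * ω₀ + c3) *
            ((Real.sqrt (1 + ϑ) * Real.sqrt Ni) * (Real.sqrt (1 + ϑ) * Real.sqrt Nl)) := by
          refine mul_le_mul_of_nonneg_left ?_ (mul_nonneg hΓ0 hΩ')
          exact mul_le_mul (hsq i) (hsq l) (by positivity) (by positivity)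
      _ = (1 + ϑ) * Γ * (ω₁ + 2 * Real.sqrt ϑ * ω₀ + c3) * (Real.sqrt Ni * Real.sqrt Nl) := by
          have e3 : Real.sqrt (1 + ϑ) * Real.sqrt (1 + ϑ) = 1 + ϑ := Real.mul_self_sqrt (by linarith)
          calc Γ * (ω₁ + 2 * Real.sqrt ϑ * ω₀ + c3) * ((Real.sqrt (1 + ϑ) * Real.sqrt Ni) * (Real.sqrt (1 + ϑ) * Real.sqrt Nl))
              = (Real.sqrt (1 + ϑ) * Real.sqrt (1 + ϑ)) * Γ * (ω₁ + 2 * Real.sqrt ϑ * ω₀ + c3) * (Real.sqrt Ni * Real.sqrt Nl) := by ring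
            _ = _ := by rw [e3]
  -- the statement's constant is literally `(1+ϑ)Γ(ω₁ + 2√ϑω₀ + c3)` (the `set`s have rewritten the goal)
  exact hfin

end Summit.QuantumFields.YangMills.Theorems.FemtoTransferGap.PScal

end
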